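import Summits.ValiantsHypothesis.ValiantsHypothesis.Theorems.ValuativeGCTValuativeBound
import Summits.ValiantsHypothesis.ValiantsHypothesis.Theorems.ValuativeGCTValuativeFlipIntegralCutOrder
import Summits.ValiantsHypothesis.ValiantsHypothesis.Theorems.ValuativeGCTValuativeBoundNegativeOrbitInvariance

/-!
# The valuative truncation is integrally closed over `ℂ[Δ(det_m)]`

Crux `ValuativeGCT.ValuativeFlip` (stmt-ValiantsHypothesis-12624), wall-breaker axis
"det-orbit-closure multiplicity bounds for the det census" (k11, gen 1): a LOWER bound of the det
census `dim T_U(λ)` by orbit-closure data finer than `K_m(λ*)`.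

The route bounds the multiplicity `K_m(λ*)` of `λ*` in `ℂ[Δ(det_m)]` by `dim T_U(λ)`
(`ValuativeBound`, landed), where the VALUATIVE clause of `T_U` asks for membership in
`I(L_U)^(δ(m-r))`, `L_U = {A ∈ End W | every row of A lies in U}`, `rank ≤ r` on `U`.  This file
proves that the valuative clause is inherited by INTEGRAL dependence:

* `icut_mem_pow_span_of_monic` (support file `…ValuativeFlipIntegralCutOrder.lean`) — over a domain, the powers of the ideal `(X_v : v ∈ T)` of a
  coordinate subspace are integrally closed: `h ^ N + Σ_{i<N} c_i h ^ i = 0` with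
  `c_i ∈ (X_T)^((N-i)e)` forces `h ∈ (X_T)^e` (lowest transverse weighted forms multiply,
  `icut_component_mul` / `icut_component_pow`; the powers are the order ideals,
  `icut_le_weight_of_mem_pow_span` / `icut_mem_pow_span_of_le_weight`);
* `icut_mem_pow_vanishingIdeal_of_monic` — the same for `I(L_U)`, EVERY linear space `U` of rows:
  an invertible right substitution straightens `U` to a coordinate subspace
  (`icut_exists_straighten`, complements + `LinearEquiv.ofFinrankEq`; the vanishing ideal of a
  coordinate row locus is the ideal of its variables, `icut_vanishingIdeal_rowLocus_coord`, by
  Lemma V of `Literature/RingTheory/MvPolynomial/VanishingOnSubspace`);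
* `icut_mem_pow_vanishingIdeal_of_homogeneous_integral` — hence every `h ∈ ℂ[End W]` with a
  homogeneous equation of integral dependence `h ^ N + Σ_{i<N} Φ(F_i) h ^ i = 0` over the pulled-back
  coordinate ring `Φ(ℂ[Sym^m]) ≅ ℂ[Δ(det_m)]` (`Φ = genericOrbitMap det_m m`, `F_i` forms of degree
  `(N-i)δ`) lies in `I(L_U)^(δ(m-r))` for every centre `U` of rank `≤ r`
  (`CoeffVanishingOrder_proof` puts `Φ(Hom_k)` in `I(L_U)^(k(m-r))`, `icut_genericOrbitMap_mem_pow`);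
* `icut_mem_truncation_of_homogeneous_integral`, `icut_finrank_le_finrank_truncation` — so the
  truncation `T_U(χ) = truncation m L_U (δ(m-r)) (mδ) χ` contains every homogeneous Stab-invariant
  `B_χ`-semi-invariant that is integral over `Φ(ℂ[Sym^m])` by a homogeneous equation, and the det
  census `dim T_U(λ)` is bounded below by the dimension of any space of such elements — the
  weight-`λ*` part of the (graded) integral closure of `ℂ[Δ(det_m)]` in `ℂ[End W]`, i.e. of the
  coordinate ring of the NORMALISATION of `Δ(det_m)` (Hüttenhain, arXiv:1512.04352 Thm 4:
  `ℂ[Nor Δ] ↪ ℂ[End W]^Stab`), uniformly in the centre `U`.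

Reading for the crux: a valuative flip `dim T_U(λ) < mult_{λ*} ℂ[Δ_m(X₀₀^{m-n} per_n)]` is
necessarily a multiplicity obstruction against the normalisation of `Δ(det_m)`, not merely against
`Δ(det_m)`; the Edmonds-gap cut can lower the det side below the symmetric Kronecker count
(`CutBites`) but never below the normalisation's count.  Elementary commutative algebra
(order-of-vanishing valuations along linear subspaces); no new definitions. [folklore]
-/

set_option linter.dupNamespace false

namespace Summit.ValiantsHypothesis.ValiantsHypothesis.Theorems.ValuativeFlip

open MvPolynomial
open scoped BigOperators Matrix
open Literature.NumberTheory.DiophantineGeometry Literature.Computability.AlgebraicComplexity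
open Summit.ValiantsHypothesis.Theorems.ValuativeBoundNegative

noncomputable section

/-! ## §2 Straightening a linear space of rows; powers of `I(L_U)` are integrally closed -/

section Transport

variable {m : ℕ}

/-- Membership in the coordinate subspace `{v | v i = 0 (i ∈ S)}`, written as an infimum of
coordinate kernels. [folklore] -/
theorem icut_mem_coordKer_iff (S : Finset (MatIdx m)) (v : MatIdx m → ℂ) :
    v ∈ (⨅ i ∈ S, LinearMap.ker (LinearMap.proj (R := ℂ) (φ := fun _ : MatIdx m => ℂ) i)) ↔
      ∀ i ∈ S, v i = 0 := by
  simp only [Submodule.mem_iInf, LinearMap.mem_ker, LinearMap.coe_proj, Function.eval]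

/-- The coordinate subspace `{v | v i = 0 (i ∈ S)}` has dimension `m² - |S|` (rank–nullity for the
projection onto the `S`-coordinates). [folklore] -/
theorem icut_finrank_coordKer (S : Finset (MatIdx m)) :
    Module.finrank ℂ ↥(⨅ i ∈ S, LinearMap.ker (LinearMap.proj (R := ℂ) (φ := fun _ : MatIdx m => ℂ) i)) =
      Fintype.card (MatIdx m) - S.card := by
  classical
  set π : (MatIdx m → ℂ) →ₗ[ℂ] (S → ℂ) :=
    LinearMap.pi fun i : S => LinearMap.proj (R := ℂ) (φ := fun _ : MatIdx m => ℂ) (i : MatIdx m) with hπ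
  have hker : LinearMap.ker π =
      ⨅ i ∈ S, LinearMap.ker (LinearMap.proj (R := ℂ) (φ := fun _ : MatIdx m => ℂ) i) := by
    ext v
    rw [icut_mem_coordKer_iff, LinearMap.mem_ker, hπ]
    simp only [LinearMap.pi_apply, LinearMap.coe_proj, Function.eval, funext_iff, Pi.zero_apply,
      Subtype.forall]
  have hsurj : Function.Surjective π := by
    intro f
    refine ⟨fun i => if h : i ∈ S then f ⟨i, h⟩ else 0, ?_⟩
    funext i
    simp [hπ, i.2]
  have hrange : Module.finrank ℂ (LinearMap.range π) = S.card := by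
    rw [LinearMap.range_eq_top.mpr hsurj, finrank_top, Module.finrank_fintype_fun_eq_card,
      Fintype.card_coe]
  have h := LinearMap.finrank_range_add_finrank_ker π
  rw [hrange, hker, Module.finrank_fintype_fun_eq_card] at h
  omega

/-- **Straightening.** Every linear space `U` of rows is carried onto a coordinate subspace by an
invertible change of coordinates of `ℂ^{MatIdx m}`: there are `S` and mutually inverse `M, M'`
with `{u | u·M ∈ U} = {v | v_i = 0 (i ∈ S)}` and `{v | v·M' ∈ coordinate subspace} = U`
(complements and `LinearEquiv.ofFinrankEq`). [folklore] -/
theorem icut_exists_straighten (U : Submodule ℂ (MatIdx m → ℂ)) :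
    ∃ (S : Finset (MatIdx m)) (M M' : Matrix (MatIdx m) (MatIdx m) ℂ), M' * M = 1 ∧
      U.comap (Matrix.vecMulLinear M) =
        (⨅ i ∈ S, LinearMap.ker (LinearMap.proj (R := ℂ) (φ := fun _ : MatIdx m => ℂ) i)) ∧
      (⨅ i ∈ S, LinearMap.ker (LinearMap.proj (R := ℂ) (φ := fun _ : MatIdx m => ℂ) i)).comap
        (Matrix.vecMulLinear M') = U := by
  classical
  have hUle : Module.finrank ℂ U ≤ Fintype.card (MatIdx m) := by
    have h := Submodule.finrank_le U
    rwa [Module.finrank_fintype_fun_eq_card] at h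
  obtain ⟨S, -, hS⟩ := Finset.exists_subset_card_eq (s := (Finset.univ : Finset (MatIdx m)))
    (n := Fintype.card (MatIdx m) - Module.finrank ℂ U) (by rw [Finset.card_univ]; omega)
  set U₀ : Submodule ℂ (MatIdx m → ℂ) :=
    ⨅ i ∈ S, LinearMap.ker (LinearMap.proj (R := ℂ) (φ := fun _ : MatIdx m => ℂ) i) with hU₀def
  have hU₀ : Module.finrank ℂ U₀ = Module.finrank ℂ U := by
    rw [hU₀def, icut_finrank_coordKer, hS]; omega
  obtain ⟨P, hP⟩ := U₀.exists_isCompl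
  obtain ⟨Q, hQ⟩ := U.exists_isCompl
  have hPQ : Module.finrank ℂ P = Module.finrank ℂ Q := by
    have h1 := Submodule.finrank_add_eq_of_isCompl hP
    have h2 := Submodule.finrank_add_eq_of_isCompl hQ
    omega
  set e₁ : U₀ ≃ₗ[ℂ] U := LinearEquiv.ofFinrankEq _ _ hU₀ with he₁
  set e₂ : P ≃ₗ[ℂ] Q := LinearEquiv.ofFinrankEq _ _ hPQ with he₂
  set e : (MatIdx m → ℂ) ≃ₗ[ℂ] (MatIdx m → ℂ) :=
    ((Submodule.prodEquivOfIsCompl _ _ hP).symm.trans (e₁.prodCongr e₂)).trans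
      (Submodule.prodEquivOfIsCompl _ _ hQ) with hedef
  have he : ∀ v ∈ U₀, e v ∈ U := by
    intro v hv
    have h1 : (Submodule.prodEquivOfIsCompl U₀ P hP).symm v = (⟨v, hv⟩, 0) :=
      Submodule.prodEquivOfIsCompl_symm_apply_left (h := hP) (x := ⟨v, hv⟩)
    rw [hedef, LinearEquiv.trans_apply, LinearEquiv.trans_apply, h1, LinearEquiv.prodCongr_apply,
      Submodule.coe_prodEquivOfIsCompl', map_zero, Submodule.coe_zero, add_zero]
    exact (e₁ ⟨v, hv⟩).2
  have hmap : U₀.map (e : (MatIdx m → ℂ) →ₗ[ℂ] (MatIdx m → ℂ)) = U := by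
    apply Submodule.eq_of_le_of_finrank_eq
    · rintro _ ⟨v, hv, rfl⟩
      exact he v hv
    · rw [LinearEquiv.finrank_map_eq]
      exact hU₀
  refine ⟨S, (LinearMap.toMatrix' (e : (MatIdx m → ℂ) →ₗ[ℂ] (MatIdx m → ℂ)))ᵀ,
    (LinearMap.toMatrix' (e.symm : (MatIdx m → ℂ) →ₗ[ℂ] (MatIdx m → ℂ)))ᵀ, ?_, ?_, ?_⟩
  · rw [← Matrix.transpose_mul, ← LinearMap.toMatrix'_comp, ← LinearEquiv.coe_trans,
      LinearEquiv.symm_trans_self, LinearEquiv.refl_toLinearMap, LinearMap.toMatrix'_id,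
      Matrix.transpose_one]
  · ext v
    rw [Submodule.mem_comap, Matrix.vecMulLinear_apply, Matrix.vecMul_transpose,
      LinearMap.toMatrix'_mulVec, LinearEquiv.coe_coe]
    constructor
    · intro hv
      rw [← hmap] at hv
      obtain ⟨u, hu, hue⟩ := hv
      rw [LinearEquiv.coe_coe] at hue
      rwa [← e.injective hue]
    · exact he v
  · ext v
    rw [Submodule.mem_comap, Matrix.vecMulLinear_apply, Matrix.vecMul_transpose,
      LinearMap.toMatrix'_mulVec, LinearEquiv.coe_coe]
    constructor
    · intro hv
      have h := he _ hv
      rwa [LinearEquiv.apply_symm_apply] at h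
    · intro hv
      rw [← hmap] at hv
      obtain ⟨u, hu, hue⟩ := hv
      rw [LinearEquiv.coe_coe] at hue
      rw [← hue, LinearEquiv.symm_apply_apply]
      exact hu

/-- The vanishing ideal of the row locus of a COORDINATE subspace is the ideal of the corresponding
variables `X_(j,i)`, `i ∈ S` (Lemma V of `Literature/RingTheory/MvPolynomial/VanishingOnSubspace`
for `⊆`; the variables vanish on the locus for `⊇`). [folklore] -/
theorem icut_vanishingIdeal_rowLocus_coord (S : Finset (MatIdx m)) :
    MvPolynomial.vanishingIdeal ℂ (rowLocus m
        (⨅ i ∈ S, LinearMap.ker (LinearMap.proj (R := ℂ) (φ := fun _ : MatIdx m => ℂ) i))) =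
      Ideal.span (X '' {v : MatIdx m × MatIdx m | v.2 ∈ S}) := by
  apply le_antisymm
  · intro G hG
    refine Literature.RingTheory.MvPolynomial.mem_ideal_span_X_image_of_forall_eval_eq_zero _ G
      fun x hx => ?_
    have hxL : x ∈ rowLocus m
        (⨅ i ∈ S, LinearMap.ker (LinearMap.proj (R := ℂ) (φ := fun _ : MatIdx m => ℂ) i)) :=
      fun j => (icut_mem_coordKer_iff S _).mpr fun i hi => hx (j, i) hi
    have h := (MvPolynomial.mem_vanishingIdeal_iff.mp hG) x hxL
    rw [← MvPolynomial.coe_aeval_eq_eval]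
    exact h
  · rw [Ideal.span_le]
    rintro _ ⟨v, hv, rfl⟩
    rw [SetLike.mem_coe, MvPolynomial.mem_vanishingIdeal_iff]
    intro x hx
    rw [aeval_X]
    exact (icut_mem_coordKer_iff S _).mp (hx v.1) v.2 hv

/-- Composition of right substitutions: `(G ∘ (·M)) ∘ (·M') = G ∘ (· (M' M))`. [folklore] -/
theorem icut_stabSubst_stabSubst (M M' : Matrix (MatIdx m) (MatIdx m) ℂ)
    (G : MvPolynomial (MatIdx m × MatIdx m) ℂ) :
    stabSubst M' (stabSubst M G) = stabSubst (M' * M) G := by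
  apply MvPolynomial.funext
  intro A
  rw [eval_stabSubst, eval_stabSubst, eval_stabSubst]
  refine congrArg (fun f : MatIdx m × MatIdx m → ℂ => eval f G) (funext fun p => ?_)
  simp only [Matrix.mul_apply, Finset.mul_sum, Finset.sum_mul]
  rw [Finset.sum_comm]
  refine Finset.sum_congr rfl fun k _ => Finset.sum_congr rfl fun l _ => ?_
  ring

/-- The right substitution by the identity matrix is the identity. [folklore] -/
theorem icut_stabSubst_one (G : MvPolynomial (MatIdx m × MatIdx m) ℂ) :
    stabSubst (1 : Matrix (MatIdx m) (MatIdx m) ℂ) G = G := by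
  apply MvPolynomial.funext
  intro A
  rw [eval_stabSubst]
  refine congrArg (fun f : MatIdx m × MatIdx m → ℂ => eval f G) (funext fun p => ?_)
  simp only [Matrix.one_apply, mul_ite, mul_one, mul_zero, Finset.sum_ite_eq',
    Finset.mem_univ, if_true, Prod.mk.eta]

/-- **Powers of `I(L_U)` are integrally closed.** For every linear space `U` of rows and the row
locus `L_U = {A | every row of A lies in U}`: if `h ^ N + Σ_{i<N} c_i h ^ i = 0` with
`c_i ∈ I(L_U)^((N-i) e)`, then `h ∈ I(L_U)^e`.  Straighten `U` to a coordinate subspace by an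
invertible right substitution (which maps `I(L_U)^t` to `I(L_{U'})^t`,
`stabSubst_mem_vanishingIdeal_pow`) and apply the coordinate case `icut_mem_pow_span_of_monic`.
Order-of-vanishing valuations along linear subspaces; [folklore]. -/
theorem icut_mem_pow_vanishingIdeal_of_monic (U : Submodule ℂ (MatIdx m → ℂ))
    (h : MvPolynomial (MatIdx m × MatIdx m) ℂ) (N e : ℕ)
    (c : ℕ → MvPolynomial (MatIdx m × MatIdx m) ℂ)
    (hc : ∀ i < N, c i ∈ MvPolynomial.vanishingIdeal ℂ (rowLocus m U) ^ ((N - i) * e))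
    (heq : h ^ N + ∑ i ∈ Finset.range N, c i * h ^ i = 0) :
    h ∈ MvPolynomial.vanishingIdeal ℂ (rowLocus m U) ^ e := by
  classical
  obtain ⟨S, M, M', hMM, hM, hM'⟩ := icut_exists_straighten U
  have heq' : (stabSubst M h) ^ N +
      ∑ i ∈ Finset.range N, stabSubst M (c i) * (stabSubst M h) ^ i = 0 := by
    have h1 := congr_arg (stabSubst M) heq
    simpa only [map_add, map_pow, map_sum, map_mul, map_zero] using h1
  have hc' : ∀ i < N, stabSubst M (c i) ∈
      Ideal.span (X '' {v : MatIdx m × MatIdx m | v.2 ∈ S}) ^ ((N - i) * e) := by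
    intro i hi
    have h1 := stabSubst_mem_vanishingIdeal_pow M (hc i hi)
    rwa [hM, icut_vanishingIdeal_rowLocus_coord] at h1
  have hh' := icut_mem_pow_span_of_monic {v : MatIdx m × MatIdx m | v.2 ∈ S} (stabSubst M h) N e
    _ hc' heq'
  rw [← icut_vanishingIdeal_rowLocus_coord] at hh'
  have h2 := stabSubst_mem_vanishingIdeal_pow M' hh'
  rwa [hM', icut_stabSubst_stabSubst, hMM, icut_stabSubst_one] at h2

end Transport

/-! ## §3 The crux's truncation: homogeneous integral dependence over `ℂ[Δ(det_m)]` -/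

section Crux

variable {m : ℕ}

/-- The generic End-orbit pull-back `Φ = genericOrbitMap det_m m` sends degree-`k` forms in the
coefficients into `I(L_U)^(k(m-r))` when every matrix of `U` has rank `≤ r` (the landed valuative
estimate `CoeffVanishingOrder_proof` on generators, `aeval_mem_pow_of_isHomogeneous` on forms).
[folklore plumbing over the tree] -/
theorem icut_genericOrbitMap_mem_pow (U : Submodule ℂ (MatIdx m → ℂ)) {r : ℕ}
    (hU : ∀ u ∈ U, (Matrix.of fun a b : Fin m => u (toLex (a, b))).rank ≤ r)
    {F : MvPolynomial (DegIdx (MatIdx m) m) ℂ} {k : ℕ} (hF : F.IsHomogeneous k) :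
    genericOrbitMap (detFormLex ℂ m) m F ∈
      MvPolynomial.vanishingIdeal ℂ (rowLocus m U) ^ (k * (m - r)) := by
  have hJ : ∀ d : DegIdx (MatIdx m) m, genericOrbitMap (detFormLex ℂ m) m (X d) ∈
      MvPolynomial.vanishingIdeal ℂ (rowLocus m U) ^ (m - r) := fun d =>
    Summit.ValiantsHypothesis.ValiantsHypothesis.Theorems.CoeffVanishingOrder.CoeffVanishingOrder_proof
      m U r hU d
  have h := Summit.ValiantsHypothesis.ValiantsHypothesis.Theorems.ValuativeBound.aeval_mem_pow_of_isHomogeneous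
    (genericOrbitMap (detFormLex ℂ m) m) _ hJ hF
  rwa [← pow_mul, mul_comm] at h

/-- **Homogeneous integral dependence over `ℂ[Δ(det_m)]` forces the valuative clause.** If
`h ^ N + Σ_{i<N} Φ(F_i) h ^ i = 0` with forms `F_i` of degree `(N-i) δ` in the coefficients (a
homogeneous equation of integral dependence of `h` over the pulled-back coordinate ring
`Φ(ℂ[Sym^m]) ≅ ℂ[Δ(det_m)]`), then `h ∈ I(L_U)^(δ(m-r))` for EVERY linear space `U` of matrices of
rank `≤ r`.  In particular the regular functions on the NORMALISATION of `Δ(det_m)` (graded integral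
closure, Hüttenhain arXiv:1512.04352 Thm 4: it sits inside `ℂ[End W]^Stab`) pass every valuative cut
of the route. [folklore] -/
theorem icut_mem_pow_vanishingIdeal_of_homogeneous_integral (U : Submodule ℂ (MatIdx m → ℂ))
    {r : ℕ} (hU : ∀ u ∈ U, (Matrix.of fun a b : Fin m => u (toLex (a, b))).rank ≤ r)
    (h : MvPolynomial (MatIdx m × MatIdx m) ℂ) (N δ : ℕ)
    (F : ℕ → MvPolynomial (DegIdx (MatIdx m) m) ℂ) (hF : ∀ i < N, (F i).IsHomogeneous ((N - i) * δ))
    (heq : h ^ N + ∑ i ∈ Finset.range N, genericOrbitMap (detFormLex ℂ m) m (F i) * h ^ i = 0) :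
    h ∈ MvPolynomial.vanishingIdeal ℂ (rowLocus m U) ^ (δ * (m - r)) := by
  refine icut_mem_pow_vanishingIdeal_of_monic U h N (δ * (m - r))
    (fun i => genericOrbitMap (detFormLex ℂ m) m (F i)) (fun i hi => ?_) heq
  have h1 := icut_genericOrbitMap_mem_pow U hU (hF i hi)
  rwa [mul_assoc] at h1

/-- **The valuative truncation is integrally closed over `ℂ[Δ(det_m)]`.** An element of
`Hom_{mδ} ⊓ Stab-invariants ⊓ B_χ-semi-invariants` that is integral over `Φ(ℂ[Sym^m])` by a
homogeneous equation lies in `T_U(χ) = truncation m L_U (δ(m-r)) (mδ) χ` for every centre `U` of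
rank `≤ r`: the valuative clause of the crux is automatic on the (graded) integral closure, so
`dim T_U(λ)` is bounded BELOW by the weight-`λ*` count of the normalisation of `Δ(det_m)`, not
only by `K_m(λ*)` (`ValuativeBound`). [folklore] -/
theorem icut_mem_truncation_of_homogeneous_integral (U : Submodule ℂ (MatIdx m → ℂ))
    {r : ℕ} (hU : ∀ u ∈ U, (Matrix.of fun a b : Fin m => u (toLex (a, b))).rank ≤ r)
    {δ : ℕ} (χ : Weight (MatIdx m)) {h : MvPolynomial (MatIdx m × MatIdx m) ℂ}
    (hhom : h ∈ MvPolynomial.homogeneousSubmodule (MatIdx m × MatIdx m) ℂ (m * δ))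
    (hstab : h ∈ stabInvariants m) (hbor : h ∈ borelSemiInvariants m χ)
    (N : ℕ) (F : ℕ → MvPolynomial (DegIdx (MatIdx m) m) ℂ)
    (hF : ∀ i < N, (F i).IsHomogeneous ((N - i) * δ))
    (heq : h ^ N + ∑ i ∈ Finset.range N, genericOrbitMap (detFormLex ℂ m) m (F i) * h ^ i = 0) :
    h ∈ truncation m (rowLocus m U) (δ * (m - r)) (m * δ) χ :=
  mem_truncation_iff.mpr ⟨hhom, icut_mem_pow_vanishingIdeal_of_homogeneous_integral U hU h N δ F hF heq,
    hstab, hbor⟩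

/-- **Census form.** Any space of homogeneous Stab-invariant `B_χ`-semi-invariants of degree `mδ`
that are integral over `Φ(ℂ[Sym^m])` by homogeneous equations has dimension at most `dim T_U(χ)`,
for every centre `U` of rank `≤ r` — the det census of the route can never drop below the
normalisation's weight-`χ` count. [folklore] -/
theorem icut_finrank_le_finrank_truncation (U : Submodule ℂ (MatIdx m → ℂ))
    {r : ℕ} (hU : ∀ u ∈ U, (Matrix.of fun a b : Fin m => u (toLex (a, b))).rank ≤ r)
    (δ : ℕ) (χ : Weight (MatIdx m)) (N' : Submodule ℂ (MvPolynomial (MatIdx m × MatIdx m) ℂ))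
    (hN' : ∀ h ∈ N', h ∈ MvPolynomial.homogeneousSubmodule (MatIdx m × MatIdx m) ℂ (m * δ) ∧
      h ∈ stabInvariants m ∧ h ∈ borelSemiInvariants m χ ∧
      ∃ (N : ℕ) (F : ℕ → MvPolynomial (DegIdx (MatIdx m) m) ℂ),
        (∀ i < N, (F i).IsHomogeneous ((N - i) * δ)) ∧
        h ^ N + ∑ i ∈ Finset.range N, genericOrbitMap (detFormLex ℂ m) m (F i) * h ^ i = 0) :
    Module.finrank ℂ N' ≤ Module.finrank ℂ (truncation m (rowLocus m U) (δ * (m - r)) (m * δ) χ) := by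
  haveI : Module.Finite ℂ (MvPolynomial.homogeneousSubmodule (MatIdx m × MatIdx m) ℂ (m * δ)) :=
    finite_homogeneousSubmodule _ _ _
  haveI : Module.Finite ℂ (truncation m (rowLocus m U) (δ * (m - r)) (m * δ) χ) :=
    Submodule.finiteDimensional_of_le fun _ hx => (mem_truncation_iff.mp hx).1
  refine Submodule.finrank_mono fun h hh => ?_
  obtain ⟨hhom, hstab, hbor, N, F, hF, heq⟩ := hN' h hh
  exact icut_mem_truncation_of_homogeneous_integral U hU χ hhom hstab hbor N F hF heq

end Crux

/-! ## Registered forms (crux stmt-ValiantsHypothesis-12624, sub-goals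
`powVanishingIdeal_rowLocus_integrallyClosed`, `valuativeClause_of_homogeneous_integral`) -/

/-- **Powers of `I(L_U)` are integrally closed** — registered sub-goal form of
`icut_mem_pow_vanishingIdeal_of_monic`, in the crux's literal vocabulary
(`L_U = {p | ∀ j, (i ↦ p (j, i)) ∈ U}`). [folklore] -/
theorem powVanishingIdeal_rowLocus_integrallyClosed :
    ∀ (m : ℕ) (U : Submodule ℂ (MatIdx m → ℂ)) (h : MvPolynomial (MatIdx m × MatIdx m) ℂ) (N e : ℕ) (c : ℕ → MvPolynomial (MatIdx m × MatIdx m) ℂ), (∀ i < N, c i ∈ MvPolynomial.vanishingIdeal ℂ {p : MatIdx m × MatIdx m → ℂ | ∀ j : MatIdx m, (fun i => p (j, i)) ∈ U} ^ ((N - i) * e)) → h ^ N + ∑ i ∈ Finset.range N, c i * h ^ i = 0 → h ∈ MvPolynomial.vanishingIdeal ℂ {p : MatIdx m × MatIdx m → ℂ | ∀ j : MatIdx m, (fun i => p (j, i)) ∈ U} ^ e :=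
  fun _ U h N e c hc heq => icut_mem_pow_vanishingIdeal_of_monic U h N e c hc heq

/-- **The valuative clause is automatic under homogeneous integral dependence over `ℂ[Δ(det_m)]`**
— registered sub-goal form of `icut_mem_pow_vanishingIdeal_of_homogeneous_integral`, in the crux's
literal vocabulary: for every centre `U` of rank `≤ r`, `h ^ N + Σ_{i<N} Φ(F_i) h ^ i = 0` with forms
`F_i` of degree `(N-i)δ` in the coefficients forces `h ∈ I(L_U)^(δ(m-r))`. [folklore] -/
theorem valuativeClause_of_homogeneous_integral :
    ∀ (m : ℕ) (U : Submodule ℂ (MatIdx m → ℂ)) (r : ℕ), (∀ u ∈ U, (Matrix.of fun a b : Fin m => u (toLex (a, b))).rank ≤ r) → ∀ (h : MvPolynomial (MatIdx m × MatIdx m) ℂ) (N δ : ℕ) (F : ℕ → MvPolynomial (DegIdx (MatIdx m) m) ℂ), (∀ i < N, (F i).IsHomogeneous ((N - i) * δ)) → h ^ N + ∑ i ∈ Finset.range N, genericOrbitMap (detFormLex ℂ m) m (F i) * h ^ i = 0 → h ∈ MvPolynomial.vanishingIdeal ℂ {p : MatIdx m × MatIdx m → ℂ | ∀ j : MatIdx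 m, (fun i => p (j, i)) ∈ U} ^ (δ * (m - r)) :=
  fun _ U _ hU h N δ F hF heq => icut_mem_pow_vanishingIdeal_of_homogeneous_integral U hU h N δ F hF heq

end

end Summit.ValiantsHypothesis.ValiantsHypothesis.Theorems.ValuativeFlip
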